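import Summits.BirchSwinnertonDyer.BirchSwinnertonDyer.Theorems.AlignedTransportAtTwoMainConjectureOfRankZeroBSDAtTwoTorsionPointField
import HarnessLib

/-!
# The `2`-torsion point field of a curve with IRREDUCIBLE `E[2]` is a CUBIC field: `[K(P) : K] = 3`
# (route `AlignedTransportAtTwo`, crux C2, line `birth`, stub A₂ — the field the class-group certificates live on)

HONEST FRAMING (cell `bsd-f1-sign2`; WIDTH-5 attached prover seat `bsd-line-att-p5` gen 2; `--supports` 22298;
closes nothing; BSD is proved for no curve here).  THEOREMS ONLY.  Continuation of `…TorsionPointField` (p597201: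
`K(P) = K̄^{Stab(P)} ⊆ K(E[4])` with `2`-power index).  There the degree of `K(P)` was not needed; the cell's
data ask D-att-p2-1 (class numbers of «the cubic field `ℚ(e₁)` and its layers of degrees `3·2ⁿ`») and the
planners' prose identify `K(P)` with the cubic field of a root of the `2`-division cubic.  This file proves the
identification's numerical shadow from the Galois side, with no polynomial algebra:

* `exists_smul_ne_of_irreducible` — if `E[2]` is irreducible (`HasIrreducibleModPGaloisRep 2`: no `Γ_K`-stable
  subgroup other than `⊥`, `⊤`), no non-zero `P ∈ E[2]` is fixed by `Γ_K` (`ℤP = {0, P}` would be stable);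
* `ncard_orbit_eq_three_of_irreducible` — hence every orbit of `Γ_K` on `E[2] ∖ 0` has exactly `3` elements (an
  orbit `{x, y}` of size `2` would make `x + y ≠ 0` a fixed point);
* `index_stabilizer_eq_three_of_irreducible`, **`finrank_fixedField_stabilizer_eq_three_of_irreducible`** —
  `[Γ_K : Stab(P)] = 3` (orbit–stabiliser) and `[K(P) : K] = 3` (Krull correspondence for the open subgroup
  `Stab(P)`, tree `finrank_fixedField_of_isOpen`);
* on the route's cell (`E/ℚ`, no rational point of order `2`) `E[2]` is irreducible by the lead's
  `AlignedTransportAtTwoSeed.irr_two_of_forall_not_hasRationalTwoTorsionX` (p583329), so every `2`-torsion point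
  field `ℚ(P)`, `P ≠ 0`, is a cubic number field and `[ℚ(E[4]) : ℚ] = 3·2^k`
  (`exists_finrank_divisionField_four_eq_three_mul_pow_of_irreducible`); this file stays ROUTE-INDEPENDENT and
  leaves that one-line specialisation to consumers.

References: [Serre1972] §IV (subgroups of `GL₂(𝔽₂) ≅ S₃`); [SilvermanAEC2009] III.6.4, VIII.§1; [NeukirchANT1999]
Ch. IV §1 (Krull's Galois correspondence).
-/

noncomputable section

open scoped Classical

universe u

namespace Summit.BirchSwinnertonDyer.BirchSwinnertonDyer.Theorems.AlignedTransportAtTwoTorsionPointField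

open WeierstrassCurve Field Literature.NumberTheory.EllipticCurves Literature.NumberTheory.GaloisRepresentations

/-! ## §9 Orbits of `Γ_K` on `E[2] ∖ 0` for irreducible `E[2]` -/

section Degree

variable {K : Type u} [Field K] [CharZero K] (W : WeierstrassCurve K) [W.IsElliptic]

omit [CharZero K] [W.IsElliptic] in
/-- The stabiliser of `P ∈ E[2]` in `Γ_K` is the stabiliser of the underlying geometric point (the action on
`E[2]` is the restricted one). [folklore] -/
theorem stabilizer_twoTorsion_eq (P : geomTorsion W 2) :
    MulAction.stabilizer (absoluteGaloisGroup K) P =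
      MulAction.stabilizer (absoluteGaloisGroup K) (P : geomPoints W) := by
  ext σ
  simp only [MulAction.mem_stabilizer_iff]
  exact ⟨fun h => congrArg Subtype.val h, fun h => Subtype.ext h⟩

omit [CharZero K] [W.IsElliptic] in
/-- The stabiliser of a `2`-torsion point is OPEN in `Γ_K` (`E(K̄)` is a discrete `Γ_K`-module, tree fact
`isOpen_stabilizer_point_holds`). [cite: SilvermanAEC2009, VIII.§1] -/
theorem isOpen_stabilizer_twoTorsion (P : geomTorsion W 2) :
    IsOpen (MulAction.stabilizer (absoluteGaloisGroup K) P : Set (absoluteGaloisGroup K)) := by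
  rw [stabilizer_twoTorsion_eq W P]
  exact isOpen_stabilizer_point_holds W (P : geomPoints W)

/-- **Irreducible `E[2]` has no non-zero `Γ_K`-fixed point**: if every `σ` fixed `P ≠ 0`, the subgroup
`ℤP = {0, P}` (of order `2` in `E[2]` of order `4`) would be `Γ_K`-stable, neither `⊥` nor `⊤`.
[cite: Serre1972, §IV] [cite: SilvermanAEC2009, Cor. III.6.4 (b)] -/
theorem exists_smul_ne_of_irreducible (hirr : W.HasIrreducibleModPGaloisRep 2) {P : geomTorsion W 2}
    (hP : P ≠ 0) : ∃ σ : absoluteGaloisGroup K, σ • P ≠ P := by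
  haveI : Fact (Nat.Prime 2) := ⟨Nat.prime_two⟩
  by_contra h
  push Not at h
  have hstab : ∀ σ : absoluteGaloisGroup K, ∀ Q ∈ AddSubgroup.zmultiples P,
      σ • Q ∈ AddSubgroup.zmultiples P := by
    intro σ Q hQ
    obtain ⟨k, rfl⟩ := AddSubgroup.mem_zmultiples_iff.mp hQ
    rw [show σ • (k • P) = k • (σ • P) from map_zsmul (DistribSMul.toAddMonoidHom (geomTorsion W 2) σ) k P,
      h σ]
    exact ⟨k, rfl⟩
  have hV : Nat.card (geomTorsion W 2) = 2 ^ 2 := natCard_geomTorsion_eq_sq_of_charZero (W := W) Nat.prime_two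
  have h2P : (2 : ℕ) • P = 0 := by
    apply Subtype.ext
    have hmem : (P : geomPoints W) ∈ AddSubgroup.torsionBy (geomPoints W) 2 := P.2
    rw [AddSubgroup.torsionBy, Submodule.mem_toAddSubgroup, Submodule.mem_torsionBy_iff] at hmem
    rw [AddSubgroupClass.coe_nsmul, ZeroMemClass.coe_zero, ← natCast_zsmul]
    exact hmem
  have hcard : Nat.card (AddSubgroup.zmultiples P) = 2 := by
    rw [Nat.card_zmultiples]; exact addOrderOf_eq_prime h2P hP
  rcases hirr (AddSubgroup.zmultiples P) hstab with hbot | htop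
  · exact hP (by simpa [hbot] using AddSubgroup.mem_zmultiples P)
  · have h4 : Nat.card (AddSubgroup.zmultiples P) = 2 ^ 2 := by
      rw [htop, AddSubgroup.card_top, hV]
    rw [hcard] at h4
    norm_num at h4

omit [CharZero K] [W.IsElliptic] in
/-- For `σ ∈ Γ_K` and `x` in the orbit of `P`, `σx` is in the orbit of `P`. [folklore] -/
private theorem smul_mem_orbit_of_mem {P x : geomTorsion W 2} (σ : absoluteGaloisGroup K)
    (hx : x ∈ MulAction.orbit (absoluteGaloisGroup K) P) :
    σ • x ∈ MulAction.orbit (absoluteGaloisGroup K) P := by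
  obtain ⟨g, rfl⟩ := MulAction.mem_orbit_iff.mp hx
  rw [← mul_smul]
  exact MulAction.mem_orbit P (σ * g)

/-- **Every `Γ_K`-orbit on `E[2] ∖ 0` has `3` elements when `E[2]` is irreducible** (`#E[2] = 4`): the orbit of
`P ≠ 0` avoids `0`, is not `{P}` (no fixed point), and is not a pair `{x, y}` (then `x + y ≠ 0` would be fixed).
[cite: Serre1972, §IV (GL₂(𝔽₂) ≅ S₃ and its subgroups)] [cite: SilvermanAEC2009, Cor. III.6.4 (b)] -/
theorem ncard_orbit_eq_three_of_irreducible (hirr : W.HasIrreducibleModPGaloisRep 2) {P : geomTorsion W 2}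
    (hP : P ≠ 0) : (MulAction.orbit (absoluteGaloisGroup K) P).ncard = 3 := by
  have hV : Nat.card (geomTorsion W 2) = 2 ^ 2 := natCard_geomTorsion_eq_sq_of_charZero (W := W) Nat.prime_two
  haveI : Finite (geomTorsion W 2) := Nat.finite_of_card_ne_zero (by rw [hV]; norm_num)
  set O := MulAction.orbit (absoluteGaloisGroup K) P with hO
  -- `O ⊆ E[2] ∖ {0}`, a set with `3` elements
  have hsub : O ⊆ (Set.univ \ {0} : Set (geomTorsion W 2)) := by
    intro x hx
    obtain ⟨g, rfl⟩ := MulAction.mem_orbit_iff.mp hx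
    refine ⟨Set.mem_univ _, ?_⟩
    rw [Set.mem_singleton_iff]
    intro h0
    exact hP (by rw [← inv_smul_smul g P, h0, smul_zero])
  have h3 : (Set.univ \ {0} : Set (geomTorsion W 2)).ncard = 3 := by
    rw [Set.ncard_sdiff_singleton_of_mem (Set.mem_univ _), Set.ncard_univ, hV]
    norm_num
  have hle : O.ncard ≤ 3 := h3 ▸ Set.ncard_le_ncard hsub (Set.toFinite _)
  have hpos : 1 ≤ O.ncard := by
    rw [Nat.one_le_iff_ne_zero, Ne, Set.ncard_eq_zero (Set.toFinite _)]
    intro h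
    have hmem : P ∈ O := MulAction.mem_orbit_self P
    rw [h] at hmem
    exact hmem
  -- not a singleton
  have hne1 : O.ncard ≠ 1 := by
    intro h1
    obtain ⟨a, ha⟩ := Set.ncard_eq_one.mp h1
    have hPO : P ∈ O := MulAction.mem_orbit_self P
    have haP : a = P := by
      rw [ha, Set.mem_singleton_iff] at hPO
      exact hPO.symm
    obtain ⟨σ, hσ⟩ := exists_smul_ne_of_irreducible W hirr hP
    apply hσ
    have hmem : σ • P ∈ O := smul_mem_orbit_of_mem W σ (MulAction.mem_orbit_self P)
    rw [ha, haP, Set.mem_singleton_iff] at hmem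
    exact hmem
  -- not a pair
  have hne2 : O.ncard ≠ 2 := by
    intro h2
    obtain ⟨x, y, hxy, hOxy⟩ := Set.ncard_eq_two.mp h2
    have hx : x ∈ O := by rw [hOxy]; exact Set.mem_insert _ _
    have hy : y ∈ O := by rw [hOxy]; exact Set.mem_insert_of_mem _ (Set.mem_singleton _)
    -- every `σ` permutes `{x, y}`, hence fixes `x + y`
    have hfix : ∀ σ : absoluteGaloisGroup K, σ • (x + y) = x + y := by
      intro σ
      have hσx : σ • x ∈ O := smul_mem_orbit_of_mem W σ hx
      have hσy : σ • y ∈ O := smul_mem_orbit_of_mem W σ hy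
      rw [hOxy] at hσx hσy
      have hne : σ • x ≠ σ • y := fun h => hxy (smul_left_cancel σ h)
      rw [smul_add]
      rcases hσx with h1 | h1 <;> rcases hσy with h2 | h2
      · exact absurd (h1.trans (Set.mem_singleton_iff.mp h2).symm) hne
      · rw [h1, Set.mem_singleton_iff.mp h2]
      · rw [Set.mem_singleton_iff.mp h1, h2, add_comm]
      · exact absurd ((Set.mem_singleton_iff.mp h1).trans (Set.mem_singleton_iff.mp h2).symm) hne
    -- `x + y ≠ 0` since `x ≠ y` and `y = -y` in `E[2]`
    have hy2 : (2 : ℤ) • y = 0 := by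
      apply Subtype.ext
      have hmem : (y : geomPoints W) ∈ AddSubgroup.torsionBy (geomPoints W) 2 := y.2
      rw [AddSubgroup.torsionBy, Submodule.mem_toAddSubgroup, Submodule.mem_torsionBy_iff] at hmem
      rw [AddSubgroupClass.coe_zsmul, ZeroMemClass.coe_zero]
      exact hmem
    have hS : x + y ≠ 0 := by
      intro h
      apply hxy
      have hx' : x = -y := eq_neg_of_add_eq_zero_left h
      rw [hx', neg_eq_iff_add_eq_zero, ← two_zsmul, hy2]
    obtain ⟨σ, hσ⟩ := exists_smul_ne_of_irreducible W hirr hS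
    exact hσ (hfix σ)
  omega

/-- **`[Γ_K : Stab(P)] = 3`** for a non-zero `P` of an irreducible `E[2]` (orbit–stabiliser, Mathlib
`MulAction.index_stabilizer`). [cite: Serre1972, §IV] -/
theorem index_stabilizer_eq_three_of_irreducible (hirr : W.HasIrreducibleModPGaloisRep 2)
    {P : geomTorsion W 2} (hP : P ≠ 0) :
    (MulAction.stabilizer (absoluteGaloisGroup K) P).index = 3 := by
  rw [MulAction.index_stabilizer, ncard_orbit_eq_three_of_irreducible W hirr hP]

/-- **The `2`-torsion point field of an irreducible `E[2]` is CUBIC: `[K(P) : K] = 3`** for every non-zero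
`P ∈ E[2]` — Krull's correspondence `[K̄^H : K] = [Γ_K : H]` for the open subgroup `H = Stab(P)` (tree
`finrank_fixedField_of_isOpen`) and `[Γ_K : Stab(P)] = 3`.  With p597201: `[K(E[4]) : K] = 3 · 2^k`.
[cite: NeukirchANT1999, Ch. IV §1 Thm. (1.2)] [cite: Serre1972, §IV] -/
theorem finrank_fixedField_stabilizer_eq_three_of_irreducible (hirr : W.HasIrreducibleModPGaloisRep 2)
    {P : geomTorsion W 2} (hP : P ≠ 0) :
    Module.finrank K (IntermediateField.fixedField (MulAction.stabilizer (absoluteGaloisGroup K) P)) = 3 := by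
  rw [finrank_fixedField_of_isOpen _ (isOpen_stabilizer_twoTorsion W P),
    index_stabilizer_eq_three_of_irreducible W hirr hP]

/-- **`[K(E[4]) : K] = 3 · 2^k` for irreducible `E[2]`** (p597201's `2`-power index over the cubic `K(P)`).
[cite: Serre1972, §IV] [cite: Lim2017FineSelmer, §3 Thm. 3.5 (hypothesis on L)] -/
theorem exists_finrank_divisionField_four_eq_three_mul_pow_of_irreducible
    (hirr : W.HasIrreducibleModPGaloisRep 2) :
    ∃ k : ℕ, Module.finrank K (W.divisionField 4) = 3 * 2 ^ k := by
  obtain ⟨P, hP⟩ := exists_twoTorsion_ne_zero W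
  obtain ⟨k, hk⟩ := exists_finrank_divisionField_four_eq_pow_mul_finrank_fixedField_stabilizer W hP
  exact ⟨k, by rw [hk, finrank_fixedField_stabilizer_eq_three_of_irreducible W hirr hP, mul_comm]⟩

end Degree


end Summit.BirchSwinnertonDyer.BirchSwinnertonDyer.Theorems.AlignedTransportAtTwoTorsionPointField

end
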